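import Mathlib
import HarnessLib
import Summits.RiemannHypothesis.RiemannHypothesis.Theorems.IntegerScrewHarmonicK
import Summits.RiemannHypothesis.RiemannHypothesis.Theorems.IntegerScrewWalkStates

/-!
# Route `IntegerScrew` — the comparison functions `h̃`, `h′` of THEOREM C♯ on the states, their `u`-derivatives
# and their limits at `u = 0` (CONTINUUM-LIMIT 16.2)

`h̃(u;x) = K(u,ρ_x)·Π(u;x)` and `h′(u;x) = h̃(u;x)·W(x)` (`K` = LEMMA G's function of `IntegerScrewHarmonicKDefs`,
`ρ_x`, `Π`, `W` of `IntegerScrewWalkStates`).  This file records the three analytic facts about them that the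
transfer step uses: the values at the state `1` (`= g(u)`), the limits `h̃, h′ → 𝟙[x = 1]` as `u → 0⁺`, and the
explicit `u`-DERIVATIVES `hTildeDeriv`, `hPrimeDeriv` with their `HasDerivAt` certificates (product rule on
(H2)'s `∂_uK = (1−ρ)e^{−uρ}c(u) + I(u,ρ)` and `∂_u Π = Σ_p θ_p e^{−uθ_p} ∏_{q ≠ p}(1 − e^{−uθ_q})`) — the `∂_u h̃`
of the exact decomposition 16.4.  Calculus only; RH-free.  Nothing here bears on the truth of RH.
References: CONTINUUM-LIMIT §16.2–16.4 (rh-explicit); M. Suzuki, J. Lond. Math. Soc. (2) 108 (2023) 1448–1487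
[Suzuki2023].
-/

noncomputable section

-- D-0017: `Summit.<S>.<S>.…` is the designed namespace of a single-problem summit.
set_option linter.dupNamespace false

namespace Summit.RiemannHypothesis.RiemannHypothesis.Theorems.IntegerScrew

open Finset Set Filter Topology Real

/-! ## The comparison functions on the states -/

/-- `h̃(u;x) = K(u,ρ_x)·∏_{p∣x}(1 − e^{−uθ_p})` (CONTINUUM-LIMIT 16.2). -/
def hTilde (L u : ℝ) (x : ℕ) : ℝ := ccpK u (room L x) * primeProd L u x

/-- `h′(u;x) = h̃(u;x)·W(x)` (CONTINUUM-LIMIT 16.2). -/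
def hPrime (L u : ℝ) (x : ℕ) : ℝ := hTilde L u x * wProd x

/-- `h̃(u;1) = K(u,1) = g(u)`. -/
theorem hTilde_one (L u : ℝ) : hTilde L u 1 = ccpK u 1 := by
  simp [hTilde, primeProd, room_one]

/-- `h′(u;1) = K(u,1) = g(u)`. -/
theorem hPrime_one (L u : ℝ) : hPrime L u 1 = ccpK u 1 := by
  simp [hPrime, hTilde_one, wProd]

/-- `h̃(u;x) → 𝟙[x = 1]` as `u → 0⁺` (`x ≥ 1`). -/
theorem tendsto_hTilde_zero (L : ℝ) {x : ℕ} (hx : x ≠ 0) :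
    Tendsto (fun u => hTilde L u x) (𝓝[>] 0) (𝓝 (if x = 1 then 1 else 0)) := by
  have hK : Tendsto (fun u => ccpK u (room L x)) (𝓝[>] 0) (𝓝 1) :=
    (tendsto_ccpK_zero (room L x)).mono_left (nhdsWithin_mono _ fun u hu => ne_of_gt hu)
  have hP : Tendsto (fun u => primeProd L u x) (𝓝[>] 0)
      (𝓝 (∏ p ∈ x.primeFactors, (1 - Real.exp (-(0 * (Real.log p / L)))))) := by
    refine tendsto_finsetProd _ fun p _ => ?_
    refine ((continuous_const.sub (Real.continuous_exp.comp ?_)).tendsto 0).mono_left nhdsWithin_le_nhds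
    fun_prop
  have hval : (∏ p ∈ x.primeFactors, (1 - Real.exp (-(0 * (Real.log p / L))))) = if x = 1 then 1 else 0 := by
    simp only [zero_mul, neg_zero, Real.exp_zero, sub_self, Finset.prod_const, zero_pow_eq,
      Finset.card_eq_zero, Nat.primeFactors_eq_empty, hx, false_or]
  rw [show (if x = 1 then (1 : ℝ) else 0) = 1 * (if x = 1 then (1 : ℝ) else 0) by ring, ← hval]
  exact hK.mul hP

/-- `h′(u;x) → 𝟙[x = 1]` as `u → 0⁺` (`x ≥ 1`). -/
theorem tendsto_hPrime_zero (L : ℝ) {x : ℕ} (hx : x ≠ 0) :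
    Tendsto (fun u => hPrime L u x) (𝓝[>] 0) (𝓝 (if x = 1 then 1 else 0)) := by
  have h := (tendsto_hTilde_zero L hx).mul_const (wProd x)
  have hval : (if x = 1 then (1 : ℝ) else 0) * wProd x = if x = 1 then 1 else 0 := by
    by_cases h1 : x = 1
    · subst h1; simp [wProd]
    · simp [h1]
  rw [hval] at h
  exact h

/-! ## The `u`-derivatives -/

/-- `∂_u Π(u;x) = Σ_{p∣x} [∏_{q∣x, q≠p}(1 − e^{−uθ_q})]·θ_p e^{−uθ_p}`. -/
def primeProdDeriv (L u : ℝ) (x : ℕ) : ℝ :=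
  ∑ p ∈ x.primeFactors, (∏ q ∈ x.primeFactors.erase p, (1 - Real.exp (-(u * (Real.log q / L))))) *
    ((Real.log p / L) * Real.exp (-(u * (Real.log p / L))))

/-- `HasDerivAt` certificate for `∂_u Π`. -/
theorem hasDerivAt_primeProd (L u : ℝ) (x : ℕ) :
    HasDerivAt (fun v => primeProd L v x) (primeProdDeriv L u x) u := by
  unfold primeProd primeProdDeriv
  have h : ∀ p ∈ x.primeFactors, HasDerivAt (fun v : ℝ => 1 - Real.exp (-(v * (Real.log p / L))))
      ((Real.log p / L) * Real.exp (-(u * (Real.log p / L)))) u := by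
    intro p _
    have h1 : HasDerivAt (fun v : ℝ => -(v * (Real.log p / L))) (-(Real.log p / L)) u :=
      ((hasDerivAt_id' u).mul_const (Real.log p / L)).fun_neg.congr_deriv (by ring)
    exact (h1.exp.const_sub 1).congr_deriv (by ring)
  refine (HasDerivAt.fun_finsetProd h).congr_deriv ?_
  simp only [smul_eq_mul]

/-- `∂_u h̃(u;x) = [(1−ρ_x)e^{−uρ_x}c(u) + I(u,ρ_x)]·Π(u;x) + K(u,ρ_x)·∂_uΠ(u;x)`. -/
def hTildeDeriv (L u : ℝ) (x : ℕ) : ℝ :=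
  ((1 - room L x) * Real.exp (-(u * room L x)) * ccpc u + ccpI u (room L x)) * primeProd L u x +
    ccpK u (room L x) * primeProdDeriv L u x

/-- `HasDerivAt` certificate for `∂_u h̃` (`u ≠ 0`). -/
theorem hasDerivAt_hTilde (L : ℝ) {u : ℝ} (hu : u ≠ 0) (x : ℕ) :
    HasDerivAt (fun v => hTilde L v x) (hTildeDeriv L u x) u := by
  unfold hTilde hTildeDeriv
  exact (hasDerivAt_ccpK hu (room L x)).mul (hasDerivAt_primeProd L u x)

/-- `∂_u h′ = ∂_u h̃ · W`. -/
def hPrimeDeriv (L u : ℝ) (x : ℕ) : ℝ := hTildeDeriv L u x * wProd x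

/-- `HasDerivAt` certificate for `∂_u h′` (`u ≠ 0`). -/
theorem hasDerivAt_hPrime (L : ℝ) {u : ℝ} (hu : u ≠ 0) (x : ℕ) :
    HasDerivAt (fun v => hPrime L v x) (hPrimeDeriv L u x) u := by
  unfold hPrime hPrimeDeriv
  exact (hasDerivAt_hTilde L hu x).mul_const (wProd x)

end Summit.RiemannHypothesis.RiemannHypothesis.Theorems.IntegerScrew

end
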